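import Mathlib
import HarnessLib
import Summits.Ventures.LatticeQCDFlow.Exactness.NCMCGeneralSpaceReplicaProductChainTStatistic
import Summits.Ventures.LatticeQCDFlow.Exactness.NCMCGeneralSpaceReplicaJackknifeDeltaMethod
import Summits.Ventures.LatticeQCDFlow.Exactness.NCMCGeneralSpaceRestartChainVarianceDichotomy
import Summits.Ventures.LatticeQCDFlow.Exactness.NCMCGeneralSpaceRestartChainEveryStart
import Summits.Ventures.LatticeQCDFlow.Exactness.NCMCGeneralSpaceIndicatorCLT

/-!
# The delete-one-block jackknife of a POOLED NONLINEAR statistic over streams with DEPENDENT starts (the product chain): coverage `→ L_R(q)`; the engine's pooled `dF ± q·dF_err` over streams branched off one run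

HONEST FRAMING: exact (Metropolis-corrected) sampling algorithms for lattice gauge theory;
figures of merit are autocorrelation/cost numbers at stated couplings and volumes; no
continuum-physics claim.

Venture `LatticeQCDFlow` (cell pub-lqcd), topic `Exactness`; FANOUT row 13 (`eng-snf`, GEN-26).
NEW WORK of the cell (elementary asymptotic statistics): the composition of GEN-24
`NCMCGeneralSpaceReplicaProductChainTStatistic` (the replica VECTOR of the product chain
`replicaSweep (fun _ ↦ κ)` converges to `N(0, σ²_f)^{⊗R}` from EVERY joint initial law), GEN-19
`sqrt_mul_mean_sub_eq`, with GEN-25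
`NCMCGeneralSpaceReplicaJackknifeDeltaMethod` (`tendsto_measure_abs_pooledJackknife_le`: the
jackknife-studentised deviation of `φ(pooled mean)` is a fixed a.e.-continuous function of the scaled
block deviations and the block means).  Not a published result; no definition; nothing cited as a
fact (jackknife / delta method NAMED ONLY).

WHY (row 13).  GEN-25's engine instance `…ReplicaJarzynskiPooledJackknife` covers `R ≥ 2`
INDEPENDENT streams (law `⊗_r P_{μ_r}`).  In practice the `R` streams of a production run are often
BRANCHED OFF ONE equilibration run — a dependent joint start — and then advanced independently, each
by its own restart chain `R = (κF ∘ₖ K).comap s`; this is exactly the product chain of GEN-24 D/D3 from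
an arbitrary joint initial record law `μ` on `ι → E`.  The block means are then dependent at every finite
`n`, but the replica vector `(√n (ȳ_{r,n} − πf))_r` still converges to the product Gaussian (D3), so
GEN-25's pooled-jackknife theorem applies VERBATIM: for every `φ` differentiable at `πf` with
`φ'(πf) ≠ 0`, every bias-correction weight `κ'` and every `q ≥ 0`, the coverage of the delete-one-block
jackknife bar of `φ(ȳ_pooled)` tends to `L_R(q) = N(0,1)^{⊗R}{|t| ≤ q}` — the engine's `free_energy`
(`φ = −log`, `πf = Z₁/Z₀`) included, from EVERY joint start of the streams.

## Content
* **`tendsto_measure_abs_pooledJackknife_le_productChain`** (§1) — `κ` Markov on `S`, `π` invariant,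
  `κ(z, ·) ≥ ε ν` (`ε ≠ 0`), `|f| ≤ C`, `σ²_f > 0`, `R = card ι ≥ 2`, `φ` with `HasDerivAt φ c (πf)`,
  `c ≠ 0`, ANY joint law `μ` on `ι → S`, free `κ'`, `q ≥ 0`: coverage `→ L_R(q)`.
* **`CrooksPair.tendsto_measure_abs_pooledJarzynskiJackknife_le_productChain`** (§2) — Crooks pair,
  `Z₀ ≠ 0`, `e^{−ΔF} = Z₁/Z₀`, `−B ≤ W`, `0 < ∫ (e^{−W} − Z₁/Z₀)² dP_F`, `K` Markov `ν₀`-invariant with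
  `m ≤ K(z, ·)` (`m` finite non-zero): the POOLED `dF (+ κ'(dF − mean of replicates)) ± q·dF_err` over
  the `R` streams of the product restart chain from ANY joint initial record law has coverage `→ L_R(q)`.

NOT CLAIMED: interacting streams; unequal stream lengths; contiguous blocks of ONE stream; `R → ∞`
with `n`; rates; anything numerical.
-/

namespace Summit.Ventures.LatticeQCDFlow.Exactness.GeneralNCMC

open MeasureTheory ProbabilityTheory Set Filter Finset Function WithLp
open Summit.Ventures.LatticeQCDFlow.Exactness
open scoped ENNReal NNReal Topology

/-! ## §1 The pooled nonlinear jackknife along the product chain -/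

section Generic

variable {ι : Type*} [DecidableEq ι] [Fintype ι] [Nontrivial ι] {S : Type*} [MeasurableSpace S]
  {κ : Kernel S S} [IsMarkovKernel κ] {π : Measure S} [IsProbabilityMeasure π]
  {ν : Measure S} [IsProbabilityMeasure ν] {ε : ℝ≥0∞}

/-- **THE DELETE-ONE-BLOCK JACKKNIFE OF `φ(POOLED MEAN)` ALONG THE PRODUCT CHAIN HAS LIMITING COVERAGE
`L_R(q)` FROM EVERY JOINT INITIAL LAW.**  `κ` Markov with invariant probability `π` and the one-step
minorisation `ε ν ≤ κ(z, ·)` (`ε ≠ 0`); `L` a duplicate-free list through all of `ι` (`R = card ι ≥ 2`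
streams, stream `r` advanced by its own draw from `κ`); `f` measurable with `|f| ≤ C` and positive
Green–Kubo variance `σ²_f`; `φ` measurable with `HasDerivAt φ c (∫ f dπ)`, `c ≠ 0`; `μ` ANY joint law of
the initial states; `κ'` real (bias-correction weight), `q ≥ 0`.  With block means
`ȳ_{r,n} = (1/n) Σ_{s<n} f(x_s(r))`:
`P(|φ(ȳ_pooled) + κ'(φ(ȳ_pooled) − (1/R)Σ_t φ(ȳ_{(−t)})) − φ(πf)| ≤ q·err_jack) → N(0,1)^{⊗R}{|t| ≤ q}`. -/
theorem tendsto_measure_abs_pooledJackknife_le_productChain (hπ : Kernel.Invariant κ π) (hε : ε ≠ 0)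
    (hmin : ∀ z, ε • ν ≤ κ z) {L : List ι} (hL : L.Nodup) (hLall : ∀ r, r ∈ L)
    {f : S → ℝ} (hf : Measurable f) {C : ℝ} (hC : ∀ x, |f x| ≤ C)
    (hσ : 0 < Scoring.autocov κ π (fun y => f y - ∫ z, f z ∂π) 0
          + 2 * ∑' t, Scoring.autocov κ π (fun y => f y - ∫ z, f z ∂π) (t + 1))
    {φ : ℝ → ℝ} (hφm : Measurable φ) {c : ℝ} (hφ : HasDerivAt φ c (∫ z, f z ∂π)) (hc : c ≠ 0)
    (μ : Measure (ι → S)) [IsProbabilityMeasure μ]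
    [IsProbabilityMeasure (Kernel.trajMeasure (X := fun _ : ℕ => ι → S) μ
        (fun n : ℕ => (replicaSweep (fun _ : ι => κ) L).comap
          (fun hh : (i : ↥(Finset.Iic n)) → ι → S => hh ⟨n, Finset.mem_Iic.2 le_rfl⟩)
          (measurable_pi_apply _)))] (κ' : ℝ) {q : ℝ} (hq : 0 ≤ q) :
    Tendsto (fun n : ℕ => (Kernel.trajMeasure (X := fun _ : ℕ => ι → S) μ
        (fun n : ℕ => (replicaSweep (fun _ : ι => κ) L).comap
          (fun hh : (i : ↥(Finset.Iic n)) → ι → S => hh ⟨n, Finset.mem_Iic.2 le_rfl⟩)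
          (measurable_pi_apply _)))
        {x : ℕ → ι → S |
          |(φ ((∑ r, (∑ s ∈ range n, f (x s r)) / n) / Fintype.card ι)
              + κ' * (φ ((∑ r, (∑ s ∈ range n, f (x s r)) / n) / Fintype.card ι)
                - (∑ t, φ ((∑ r ∈ univ.erase t, (∑ s ∈ range n, f (x s r)) / n)
                    / ((Fintype.card ι : ℝ) - 1))) / Fintype.card ι)
              - φ (∫ z, f z ∂π))
            / Real.sqrt (((Fintype.card ι : ℝ) - 1) / Fintype.card ι
              * ∑ r, (φ ((∑ u ∈ univ.erase r, (∑ s ∈ range n, f (x s u)) / n)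
                    / ((Fintype.card ι : ℝ) - 1))
                - (∑ t, φ ((∑ u ∈ univ.erase t, (∑ s ∈ range n, f (x s u)) / n)
                    / ((Fintype.card ι : ℝ) - 1))) / Fintype.card ι) ^ 2)| ≤ q})
      atTop
      (𝓝 ((Measure.pi fun _ : ι => gaussianReal 0 1) {z : ι → ℝ | |(∑ r, z r) / Fintype.card ι
        / Real.sqrt ((∑ r, (z r - (∑ r', z r') / Fintype.card ι) ^ 2)
            / ((Fintype.card ι : ℝ) * (Fintype.card ι - 1)))| ≤ q})) := by
  have hv : Real.toNNReal (Scoring.autocov κ π (fun y => f y - ∫ z, f z ∂π) 0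
      + 2 * ∑' t, Scoring.autocov κ π (fun y => f y - ∫ z, f z ∂π) (t + 1)) ≠ 0 := by
    rw [ne_eq, Real.toNNReal_eq_zero, not_le]
    exact hσ
  -- the replica VECTOR of the product chain, rewritten as `√n`-scaled deviations of the block means
  have hvec := tendstoInDistribution_replicaVector_productChain hπ hε hmin hL hLall hf hC μ
  have hA : ∀ n : ℕ, Measurable fun (x : ℕ → ι → S) (r : ι) => (∑ s ∈ range n, f (x s r)) / n :=
    fun n => measurable_pi_lambda _ fun r => (Finset.measurable_sum _ fun s _ =>
      hf.comp ((measurable_pi_apply r).comp (measurable_pi_apply s))).div_const _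
  have hvec' : TendstoInDistribution (fun (n : ℕ) (x : ℕ → ι → S) =>
        toLp 2 (fun r => Real.sqrt (n : ℝ) * ((∑ s ∈ range n, f (x s r)) / n - ∫ z, f z ∂π)))
      atTop (toLp 2) (fun _ => Kernel.trajMeasure (X := fun _ : ℕ => ι → S) μ
        (fun n : ℕ => (replicaSweep (fun _ : ι => κ) L).comap
          (fun hh : (i : ↥(Finset.Iic n)) → ι → S => hh ⟨n, Finset.mem_Iic.2 le_rfl⟩)
          (measurable_pi_apply _)))
      (Measure.pi fun _ : ι => gaussianReal 0 (Real.toNNReal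
        (Scoring.autocov κ π (fun y => f y - ∫ z, f z ∂π) 0
          + 2 * ∑' k, Scoring.autocov κ π (fun y => f y - ∫ z, f z ∂π) (k + 1)))) := by
    refine hvec.congr (fun n => Eventually.of_forall fun x => ?_) Filter.EventuallyEq.rfl
    congr 1
    funext r
    exact (sqrt_mul_mean_sub_eq (fun s => f (x s r)) _ n).symm
  exact tendsto_measure_abs_pooledJackknife_le hA hφm hφ hc hv hvec' κ' hq

end Generic

/-! ## §2 The engine's pooled `dF` over streams branched off one run -/

variable {Ω E : Type*} [MeasurableSpace Ω] [MeasurableSpace E]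

namespace CrooksPair

variable {ν₀ ν₁ : Measure Ω} [IsFiniteMeasure ν₀] [IsFiniteMeasure ν₁] {κF κR : Kernel Ω E}
  [IsMarkovKernel κF] [IsMarkovKernel κR] {s e : E → Ω} {W : E → ℝ}
  {ι : Type*} [Fintype ι] [DecidableEq ι] [Nontrivial ι]

omit [IsFiniteMeasure ν₁] in
/-- **THE ENGINE'S POOLED `dF (+ κ'·(dF − mean)) ± q·dF_err` OVER `R ≥ 2` STREAMS WITH A DEPENDENT
JOINT START HAS LIMITING COVERAGE `L_R(q)`.**  Crooks pair, `Z₀ ≠ 0`, `e^{−ΔF} = Z₁/Z₀`, `−B ≤ W`,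
`0 < ∫ (e^{−W} − Z₁/Z₀)² dP_F`; `K` Markov, `ν₀`-invariant, `m ≤ K(z, ·)` for all `z` (`m` finite,
non-zero); the `R` record streams start from ANY joint law `μ` on `ι → E` (e.g. all branched off one
run) and are then advanced independently, stream `r` by its own restart chain
`(κF ∘ₖ K).comap s` (the product chain `replicaSweep`, swept through a duplicate-free list `L` of all
streams); `ȳ_{r,n}` = mean weight `e^{−W}` of the first `n` records of stream `r`; `κ'` real, `q ≥ 0`. -/
theorem tendsto_measure_abs_pooledJarzynskiJackknife_le_productChain (K : Kernel Ω Ω)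
    [IsMarkovKernel K] (h0 : ν₀ univ ≠ 0) (hK : Kernel.Invariant K ν₀)
    (h : CrooksPair ν₀ ν₁ κF κR s e W) {ΔF : ℝ}
    (hΔF : Real.exp (-ΔF) = ((ν₀ univ)⁻¹ * ν₁ univ).toReal) {m : Measure Ω} [IsFiniteMeasure m]
    (hm0 : m univ ≠ 0) (hmin : ∀ z, m ≤ K z) {B : ℝ} (hB : ∀ ω, -B ≤ W ω)
    (hV : 0 < ∫ ω, (Real.exp (-W ω) - ((ν₀ univ)⁻¹ * ν₁ univ).toReal) ^ 2 ∂(fwdPathLaw ν₀ κF))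
    {L : List ι} (hL : L.Nodup) (hLall : ∀ r, r ∈ L)
    (μ : Measure (ι → E)) [IsProbabilityMeasure μ]
    [IsProbabilityMeasure (Kernel.trajMeasure (X := fun _ : ℕ => ι → E) μ
        (fun n : ℕ => (replicaSweep (fun _ : ι => (κF ∘ₖ K).comap s h.measurable_s) L).comap
          (fun hh : (i : ↥(Finset.Iic n)) → ι → E => hh ⟨n, Finset.mem_Iic.2 le_rfl⟩)
          (measurable_pi_apply _)))] (κ' : ℝ) {q : ℝ} (hq : 0 ≤ q) :
    Tendsto (fun n : ℕ => (Kernel.trajMeasure (X := fun _ : ℕ => ι → E) μ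
        (fun n : ℕ => (replicaSweep (fun _ : ι => (κF ∘ₖ K).comap s h.measurable_s) L).comap
          (fun hh : (i : ↥(Finset.Iic n)) → ι → E => hh ⟨n, Finset.mem_Iic.2 le_rfl⟩)
          (measurable_pi_apply _)))
        {x : ℕ → ι → E |
          |(-Real.log ((∑ r, (∑ i ∈ range n, Real.exp (-W (x i r))) / n) / Fintype.card ι)
              + κ' * (-Real.log ((∑ r, (∑ i ∈ range n, Real.exp (-W (x i r))) / n) / Fintype.card ι)
                - (∑ t, -Real.log ((∑ r ∈ univ.erase t, (∑ i ∈ range n, Real.exp (-W (x i r))) / n)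
                    / ((Fintype.card ι : ℝ) - 1))) / Fintype.card ι)
              - ΔF)
            / Real.sqrt (((Fintype.card ι : ℝ) - 1) / Fintype.card ι
              * ∑ r, (-Real.log ((∑ u ∈ univ.erase r, (∑ i ∈ range n, Real.exp (-W (x i u))) / n)
                    / ((Fintype.card ι : ℝ) - 1))
                - (∑ t, -Real.log ((∑ u ∈ univ.erase t, (∑ i ∈ range n, Real.exp (-W (x i u))) / n)
                    / ((Fintype.card ι : ℝ) - 1))) / Fintype.card ι) ^ 2)|
            ≤ q})
      atTop
      (𝓝 ((Measure.pi fun _ : ι => gaussianReal 0 1) {z : ι → ℝ | |(∑ r, z r) / Fintype.card ι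
        / Real.sqrt ((∑ r, (z r - (∑ r', z r') / Fintype.card ι) ^ 2)
            / ((Fintype.card ι : ℝ) * (Fintype.card ι - 1)))| ≤ q})) := by
  haveI := isProbabilityMeasure_fwdPathLaw ν₀ h0 κF
  haveI := isProbabilityMeasure_normalised_bind_kernel κF hm0
  set θ : ℝ := ((ν₀ univ)⁻¹ * ν₁ univ).toReal with hθdef
  have hθ : 0 < θ := by rw [← hΔF]; exact Real.exp_pos _
  have hlogθ : -Real.log θ = ΔF := by rw [← hΔF, Real.log_exp, neg_neg]
  have hint : ∫ z, Real.exp (-W z) ∂(fwdPathLaw ν₀ κF) = θ := h.integral_exp_neg_work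
  -- bounded-below work gives a bounded weight
  have hC : ∀ ω, |Real.exp (-W ω)| ≤ Real.exp B := fun ω => by
    rw [abs_of_pos (Real.exp_pos _)]
    exact Real.exp_le_exp.2 (by linarith [hB ω])
  -- one-step minorisation of the restart kernel by the probability measure `(m(Ω))⁻¹ m ∘ κF`
  have hmin' : ∀ z, m univ • ((m univ)⁻¹ • m.bind κF) ≤ ((κF ∘ₖ K).comap s h.measurable_s) z :=
    fun z => by
      have hz := restartKernel_nHit_one_minorised K h hm0 hmin z
      rwa [nHit_one] at hz
  -- the checkable variance hypothesis gives a positive Green–Kubo variance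
  have hσ : 0 < Scoring.autocov ((κF ∘ₖ K).comap s h.measurable_s) (fwdPathLaw ν₀ κF)
        (fun ω => Real.exp (-W ω) - ∫ z, Real.exp (-W z) ∂(fwdPathLaw ν₀ κF)) 0
      + 2 * ∑' t, Scoring.autocov ((κF ∘ₖ K).comap s h.measurable_s) (fwdPathLaw ν₀ κF)
        (fun ω => Real.exp (-W ω) - ∫ z, Real.exp (-W z) ∂(fwdPathLaw ν₀ κF)) (t + 1) := by
    rw [hint]
    exact (h.greenKubo_variance_exp_neg_work_restartChain_pos_iff K h0 hK hm0 hmin hB).2 hV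
  have hmain := tendsto_measure_abs_pooledJackknife_le_productChain
    (h.invariant_restartKernel K hK) hm0 hmin' hL hLall (f := fun ω => Real.exp (-W ω))
    (Real.measurable_exp.comp h.measurable_W.neg) hC hσ
    (φ := fun x => -Real.log x) Real.measurable_log.neg
    (by rw [hint]; exact (Real.hasDerivAt_log hθ.ne').neg)
    (neg_ne_zero.2 (inv_ne_zero hθ.ne')) μ κ' hq
  rw [hint, hlogθ] at hmain
  exact hmain

end CrooksPair

end Summit.Ventures.LatticeQCDFlow.Exactness.GeneralNCMC
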